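import Literature.NumberTheory.GaloisRepresentations.CyclicExtensionOfInvariantRep
import Literature.NumberTheory.GaloisRepresentations.FramedRepEquivConj
import Literature.NumberTheory.Automorphic.ChebotarevArtinRepHolds
import HarnessLib

/-!
# A Frobenius-stable irreducible Galois representation extends across a cyclic layer

Topic `NumberTheory/GaloisRepresentations`; namespace
`Literature.NumberTheory.GaloisRepresentations`.  Theorems only: **no definition and no named
fact is introduced**.

Let `M/F` be a finite Galois extension of number fields with CYCLIC Galois group `Gal(M/F)`,
`A` an algebraically closed Hausdorff topological field of characteristic `0` (`ℚ̄_ℓ`, `ℂ`, …),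
and `ρ' : Γ_M → GL_n(A)` an IRREDUCIBLE framed Galois representation
(`FramedGaloisRep M A n`) which is unramified at all but finitely many places of `M` and whose
Frobenius data are **`Gal(M/F)`-stable**: for every `σ ∈ Gal(M/F)` and all but finitely many
places `w` of `M`, `ρ'` has the *same* characteristic polynomial of Frobenius at `w` and at
`σ • w` (`FramedGaloisRep.HasFrobCharpolyAt`; the action of `Gal(M/F)` on the finite places of
`M` is the `MulAction` of `Automorphic/GaloisActionPlaces`).  Then **`ρ'` is the restriction
`ρ|_{Γ_M}` (`FramedGaloisRep.restrictField`, along `absGaloisRestrict F M`) of a framed Galois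
representation `ρ : Γ_F → GL_n(A)`** (`FramedGaloisRep.exists_restrictField_eq_of_frobStable`).

This is the Galois side of cyclic (prime-degree) DESCENT in the theory of base change for
`GL_n` (Arthur–Clozel 1989, Ch. 3, Thm. 4.2): if `Π ≅ Π^σ` is a `σ`-stable cuspidal automorphic
representation of `GL_n(𝔸_M)`, `Gal(M/F) = ⟨σ⟩`, its Galois representation `ρ' = r_ι(Π)` has
`Gal(M/F)`-stable Frobenius data (the Satake parameters of `Π` at `w` and `σ w` agree), and one
needs a representation of `Γ_F` restricting to `ρ'` — exactly as in Harris–Taylor's proof of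
Thm. VII.1.9 (pp. 229–232: "It follows from the Čebotarev density theorem that
`[R_l(Res(Π))^{σ_A}] = [R_l(Res(Π))]` … and so `R_l(Res(Π))` extends to a continuous
representation of `Gal(L̄/F_A)`").

Proof.  Fix `τ ∈ Γ_F` with image `τ̄ = absGaloisQuot F M τ ∈ Gal(M/F)`.  An irreducible
representation is semisimple (a simple lattice of subrepresentations is complemented), so
Chebotarev + Brauer–Nesbitt in the form `FramedGaloisRep.nonempty_equiv_outerConj`
(`AbsGaloisOuterConj`; its Chebotarev hypothesis is the tree's PROVED
`Literature.NumberTheory.Automorphic.chebotarev_artinRep_holds`) applied to the stability at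
`σ := τ̄` gives an isomorphism `ρ'^τ ≅ ρ'` of the continuous representations on `Aⁿ`
(`ρ'^τ = FramedGaloisRep.outerConj τ ρ'`); equivalent framed representations are conjugate
(`FramedRep.exists_eq_conj_of_equiv`), so `P · ρ'^τ · P⁻¹ = ρ'` for some `P ∈ GL_n(A)`
(`FramedGaloisRep.exists_conj_outerConj_eq_of_frobStable`).  This is the invariance hypothesis
of the extension theorem across a normal subgroup of cyclic index (Clifford 1937, §§3–4;
`FramedGaloisRep.exists_restrictField_eq_of_forall_outerConj` of
`CyclicExtensionOfInvariantRep`), which produces `ρ`.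

## Main results

* `FramedGaloisRep.exists_conj_outerConj_eq_of_frobStable` — Frobenius stability a.e. forces
  every conjugate `ρ'^τ`, `τ ∈ Γ_F`, to be a change of frame of `ρ'` (any Galois extension of
  number fields `M/F`, `ρ'` irreducible).
* `FramedGaloisRep.exists_restrictField_eq_of_frobStable` — the extension to `Γ_F` for
  `Gal(M/F)` cyclic.

Design notes.  The extension is an EQUALITY `ρ|_{Γ_M} = ρ'` of framed representations; `ρ` is
unique up to twist by a character of `Gal(M/F)`
(`FramedGaloisRep.exists_twist_of_restrictField_eq`, `CliffordTwistOfRestriction`).  Not here: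
any automorphic statement (the stability of the Frobenius data of a base change is supplied by
the consumer).

## References

* M. Harris, R. Taylor, *The geometry and cohomology of some simple Shimura varieties*, Ann. of
  Math. Stud. 151 (2001), proof of Thm. VII.1.9, pp. 229–232. [HarrisTaylorAMS2001]
* A. H. Clifford, *Representations induced in an invariant subgroup*, Ann. of Math. 38 (1937),
  533–550, §§3–4. [Clifford1937]
* G. Chenevier, M. Harris, *Construction of automorphic Galois representations, II*, Camb. J.
  Math. 1 (2013), §3.1, pp. 63–64. [ChenevierHarris2013]
* J. Arthur, L. Clozel, *Simple algebras, base change, and the advanced theory of the trace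
  formula*, Ann. of Math. Stud. 120 (1989), Ch. 3, Thm. 4.2. [ArthurClozelAMS120]
-/

open scoped NumberField
open Field IsDedekindDomain

namespace Literature.NumberTheory.GaloisRepresentations

universe v

/-- **Galois-stable Frobenius data make every conjugate of an irreducible `ρ'` a change of
frame.**  Let `M/F` be a Galois extension of number fields, `A` a Hausdorff topological field of
characteristic `0`, and `ρ' : Γ_M → GL_n(A)` an irreducible framed Galois representation,
unramified almost everywhere, with the same characteristic polynomial of Frobenius at `w` and at
`σ • w` for every `σ ∈ Gal(M/F)` and almost all `w`.  Then for every `τ ∈ Γ_F` the conjugate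
`ρ'^τ` (`FramedGaloisRep.outerConj`) satisfies `P · ρ'^τ · P⁻¹ = ρ'` for some `P ∈ GL_n(A)`:
`ρ'` is semisimple, so `ρ'^τ ≅ ρ'` by Chebotarev + Brauer–Nesbitt
(`FramedGaloisRep.nonempty_equiv_outerConj`, fed with the proved
`Automorphic.chebotarev_artinRep_holds`), and equivalent framed representations are conjugate
(`FramedRep.exists_eq_conj_of_equiv`).
[cite: HarrisTaylorAMS2001, proof of Thm. VII.1.9 (p. 230)] -/
theorem FramedGaloisRep.exists_conj_outerConj_eq_of_frobStable {F M : Type} [Field F] [Field M]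
    [NumberField M] [Algebra F M] [IsGalois F M] {A : Type v} [Field A] [TopologicalSpace A]
    [IsTopologicalRing A] [T2Space A] [CharZero A] {n : ℕ} (ρ' : FramedGaloisRep M A n)
    (hirr : ρ'.IsIrreducible)
    (hunr : ∀ᶠ w : HeightOneSpectrum (𝓞 M) in Filter.cofinite, ρ'.IsUnramifiedAt w)
    (hstab : ∀ σ : M ≃ₐ[F] M, ∀ᶠ w : HeightOneSpectrum (𝓞 M) in Filter.cofinite,
      ∃ P : Polynomial A, ρ'.HasFrobCharpolyAt w P ∧ ρ'.HasFrobCharpolyAt (σ • w) P)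
    (τ : absoluteGaloisGroup F) :
    ∃ P : GL (Fin n) A, FramedRep.conj P (ρ'.outerConj τ) = ρ' := by
  -- an irreducible representation is semisimple (a simple lattice is complemented)
  have hss : ρ'.toGaloisRep.IsSemisimple := by
    haveI : Representation.IsIrreducible ρ'.toGaloisRep.toRepresentation := hirr
    change ComplementedLattice _
    infer_instance
  -- Chebotarev + Brauer–Nesbitt: `ρ'^τ ≅ ρ'`
  obtain ⟨e⟩ := FramedGaloisRep.nonempty_equiv_outerConj Automorphic.chebotarev_artinRep_holds
    ρ' hss τ hunr (hstab (absGaloisQuot F M τ))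
  -- equivalent framed representations are conjugate
  obtain ⟨P, hP⟩ := FramedRep.exists_eq_conj_of_equiv (ρ'.outerConj τ) ρ' e
  exact ⟨P, hP.symm⟩

/-- **A Frobenius-stable irreducible Galois representation of `Γ_M` extends across a cyclic
layer `M/F`.**  Let `M/F` be a finite Galois extension of number fields with `Gal(M/F)` cyclic,
`A` an algebraically closed Hausdorff topological field of characteristic `0`, and
`ρ' : Γ_M → GL_n(A)` an irreducible framed Galois representation, unramified at all but finitely
many places, such that for every `σ ∈ Gal(M/F)` and all but finitely many places `w` of `M` the
characteristic polynomials of Frobenius of `ρ'` at `w` and at `σ • w` coincide.  Then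
`ρ' = ρ|_{Γ_M}` (`FramedGaloisRep.restrictField`) for a framed Galois representation `ρ` of
`Γ_F`: by `exists_conj_outerConj_eq_of_frobStable` every conjugate `ρ'^τ`, `τ ∈ Γ_F`, is a change
of frame of `ρ'`, and an invariant irreducible representation of a normal subgroup of cyclic
index extends (Clifford 1937, §§3–4;
`FramedGaloisRep.exists_restrictField_eq_of_forall_outerConj`).  This is how the Galois
representation of a `σ`-stable (base-changed) cuspidal automorphic representation of
`GL_n(𝔸_M)` is descended to `Γ_F` in Harris–Taylor's proof of Thm. VII.1.9.
[cite: HarrisTaylorAMS2001, proof of Thm. VII.1.9 (pp. 229–232)] -/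
theorem FramedGaloisRep.exists_restrictField_eq_of_frobStable {F M : Type} [Field F] [Field M]
    [NumberField M] [Algebra F M] [IsGalois F M] [CharZero F] [FiniteDimensional F M]
    [IsCyclic (M ≃ₐ[F] M)] {A : Type v} [Field A] [TopologicalSpace A] [IsTopologicalRing A]
    [T2Space A] [CharZero A] [IsAlgClosed A] {n : ℕ} (ρ' : FramedGaloisRep M A n)
    (hirr : ρ'.IsIrreducible)
    (hunr : ∀ᶠ w : HeightOneSpectrum (𝓞 M) in Filter.cofinite, ρ'.IsUnramifiedAt w)
    (hstab : ∀ σ : M ≃ₐ[F] M, ∀ᶠ w : HeightOneSpectrum (𝓞 M) in Filter.cofinite,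
      ∃ P : Polynomial A, ρ'.HasFrobCharpolyAt w P ∧ ρ'.HasFrobCharpolyAt (σ • w) P) :
    ∃ ρ : FramedGaloisRep F A n, ρ.restrictField M = ρ' :=
  FramedGaloisRep.exists_restrictField_eq_of_forall_outerConj ρ' hirr
    (FramedGaloisRep.exists_conj_outerConj_eq_of_frobStable ρ' hirr hunr hstab)

end Literature.NumberTheory.GaloisRepresentations
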